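import Summits.ABC.IUTFork.Cor312PilotIdelesPrArchThetaSide
import Summits.ABC.IUTFork.Cor312PilotIdelesPrWitness
import HarnessLib

/-!
# [IUTchIII] Corollary 3.12 at the FOURTH CORNER (print-normalised weights, honest archimedean place): NON-VACUITY of the idele binders —
# realising Θ- and q-ideles EXIST ([IUTchI] Ex. 3.2 (iv): `2l ∣ ord_v(q_v)` on `S`), and for them every conclusion of
# `Cor312PilotIdelesPrArch` / `…ThetaSide` holds at once

PROOF-ONLY record file (D-0012; no definitions) of the abc-iut cell (Cor. 3.12 sub-crew, seat abc-iut-c312-7, gen 3; twin of this seat's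
`Cor312PilotIdelesPrWitness` (p425344) at abc-iut-w5-d163's honest-`∞` setting); TAKES NO SIDE. From abc-iut-c312-3's
`exists_realising_thetaIdeles` / `exists_realising_qIdeles` under the DISPLAYED arithmetic side condition `2l ∣ ord_v(q_v)` for `v ∈ S`:

* **`exists_ideles_settingPrVolArchSharp`** — ∃ `t`, `t_q` (non-zero, realising `P_Θ`, `P_q`, units off `S`) such that at
  `settingPrVolArchSharp … t tq`: `ThetaFinite ∧ BridgeHyps ∧ ThetaRegionsAdm ∧ negLogQ = −ndeg(P_q) ∧ AbsLogQPos ∧ (Statement ↔ ↑(−ndeg P_q) ≤ −|log Θ|)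
  ∧ (GlobalVolumeTransport ↔ −ndeg(P_q) ≤ −ndegLgp(P_Θ) + PN(|S^±|·log π))` — so the fourth-corner statements are about an INHABITED family of
  settings (for every choice of the free context binders `n`, lattice, signature, `q`-data, archimedean/(b)(c) structures).
[claim: Mochizuki2012, status: disputed] for the setting; [cite: DupuyHilado2025, §3.3, §3.4]; [cite: Mochizuki2012, IUTchI Ex. 3.2 (iv)].
Numbers at one instantiation; no judgement on Cor. 3.12. typed ≠ proved; instantiated ≠ endorsed.
-/

noncomputable section

open Set Function NumberField IsDedekindDomain
open scoped Pointwise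

namespace Summit.ABC

namespace IUTFork

namespace Thm311

namespace Real

open Cor312 Cor312Vol Literature.IUT.LogThetaLattice Literature.IUT.LogVolume

variable {F : Type} [Field F] [NumberField F] (X : PilotData F) {logv : PadicLogs F} (hlog : LogvAnalytic logv)
  (hc : ∀ w : InfinitePlace F, w.IsComplex)
variable (M : Type) [Field M] [NumberField M]
  (archPk : ∀ (j : (thetaIndex X).Label) (vQ : (thetaIndex X).VQ), Set ((logShellsDH X logv).Packet j vQ))
  (archSub : ∀ (j : (thetaIndex X).Label) (v : (thetaIndex X).V),
    Set ((logShellsDH X logv).Packet j ((thetaIndex X).over v)))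
  (Ψ : ℤ → ∀ v : (thetaIndex X).V, v ∈ (thetaIndex X).Vbad → Set ((logShellsDH X logv).StarPacket v))
  (act : ℤ → ∀ v : (thetaIndex X).V, v ∈ (thetaIndex X).Vbad →
    (logShellsDH X logv).StarPacket v → Module.End ℚ ((logShellsDH X logv).StarPacket v))
  (Mmod : ℤ → ∀ j : (thetaIndex X).LabelStar, Set ((logShellsDH X logv).GlobalPacket j.1))
  (region : ℤ → ∀ j : (thetaIndex X).LabelStar, FinDivisor M → ∀ vQ : (thetaIndex X).VQ,
    Set ((logShellsDH X logv).Packet j.1 vQ))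
  (n : ℤ) {HT : Type} {LogLink : HT → HT → Type} {IsFull : ∀ {s t : HT}, LogLink s t → Prop}
  (lat : LGPGaussianLogThetaLattice LogLink IsFull)
  {Frd : Type} {IsoF : Frd → Frd → Type} {Ob : Frd → Type} {realify : Frd → Frd} {Strip : Type}
  {IsoS : Strip → Strip → Type} {Mv : ∀ v : (thetaIndex X).V, v ∈ (thetaIndex X).Vbad → Type}
  [∀ v h, Monoid (Mv v h)]
  (sig : GlobalLGPFrobenioidSignature (thetaIndex X).lstar (thetaIndex X).V (· ∈ (thetaIndex X).Vbad)
    Frd IsoF Ob realify Strip IsoS Mv)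
  (split : SplittingMonoids Mv) {ObΔ : Type} {N : ∀ v : (thetaIndex X).V, v ∈ (thetaIndex X).Vbad → Type}
  [∀ v h, Monoid (N v h)] (qData : QPilotData ObΔ N)

/-- **NON-VACUITY at the fourth corner**: realising ideles exist under `2l ∣ ord_v(q_v)` on `S`, and for them every conclusion of
`Cor312PilotIdelesPrArch` / `Cor312PilotIdelesPrArchThetaSide` holds simultaneously. [cite: DupuyHilado2025, §3.3, §3.4] -/
theorem exists_ideles_settingPrVolArchSharp (hdiv : ∀ v ∈ X.S, (2 * X.l : ℤ) ∣ X.ordq v) :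
    ∃ (t : ∀ (pp : Nat.Primes) (_ : Fin X.lstar) (x : (thetaIndex X).Fibre (.inr pp)),
          haveI : Fact (pp : ℕ).Prime := ⟨pp.2⟩; kOf X pp.1 x)
      (tq : ∀ (pp : Nat.Primes) (x : (thetaIndex X).Fibre (.inr pp)), haveI : Fact (pp : ℕ).Prime := ⟨pp.2⟩; kOf X pp.1 x)
      (_ : ∀ pp i x, t pp i x ≠ 0)
      (_ : ∀ (pp : Nat.Primes) (i : Fin X.lstar) (x : (thetaIndex X).Fibre (.inr pp)),
          haveI : Fact (pp : ℕ).Prime := ⟨pp.2⟩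
          Real.log ‖t pp i x‖ = -(X.thetaPilot i (placeOf X pp.1 x)) * logNorm F (placeOf X pp.1 x) /
            localDegree F (placeOf X pp.1 x))
      (htq0 : ∀ pp x, tq pp x ≠ 0)
      (htq1 : ∀ (pp : Nat.Primes) (x : (thetaIndex X).Fibre (.inr pp)),
          haveI : Fact (pp : ℕ).Prime := ⟨pp.2⟩; placeOf X pp.1 x ∉ X.S → ‖tq pp x‖ = 1)
      (_ : ∀ (pp : Nat.Primes) (x : (thetaIndex X).Fibre (.inr pp)),
          haveI : Fact (pp : ℕ).Prime := ⟨pp.2⟩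
          Real.log ‖tq pp x‖ = -(X.qPilot (placeOf X pp.1 x)) * logNorm F (placeOf X pp.1 x) /
            localDegree F (placeOf X pp.1 x)),
      (settingPrVolArchSharp X hlog hc M archPk archSub Ψ act Mmod region n lat sig split qData t tq htq0 htq1).ThetaFinite ∧
      BridgeHyps (settingPrVolArchSharp X hlog hc M archPk archSub Ψ act Mmod region n lat sig split qData t tq htq0 htq1) ∧
      ThetaRegionsAdm (settingPrVolArchSharp X hlog hc M archPk archSub Ψ act Mmod region n lat sig split qData t tq htq0 htq1) ∧
      (settingPrVolArchSharp X hlog hc M archPk archSub Ψ act Mmod region n lat sig split qData t tq htq0 htq1).negLogQ =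
          -FinDivisor.ndeg F X.qPilot ∧
      (settingPrVolArchSharp X hlog hc M archPk archSub Ψ act Mmod region n lat sig split qData t tq htq0 htq1).AbsLogQPos ∧
      ((settingPrVolArchSharp X hlog hc M archPk archSub Ψ act Mmod region n lat sig split qData t tq htq0 htq1).Statement ↔
        (((-FinDivisor.ndeg F X.qPilot : ℝ) : WithTop ℝ) ≤
          (settingPrVolArchSharp X hlog hc M archPk archSub Ψ act Mmod region n lat sig split qData t tq htq0 htq1).negLogTheta)) ∧
      (GlobalVolumeTransport
          (settingPrVolArchSharp X hlog hc M archPk archSub Ψ act Mmod region n lat sig split qData t tq htq0 htq1) ↔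
        -FinDivisor.ndeg F X.qPilot ≤ -LgpDivisor.ndegLgp X.thetaPilot +
          processionNormalized (fun i : Fin (thetaIndex X).lstar =>
            (Fintype.card ((thetaIndex X).Caps (Setting.labelSucc i)) : ℝ) * Real.log Real.pi)) := by
  obtain ⟨t, ht0, ht⟩ := exists_realising_thetaIdeles X hdiv
  obtain ⟨tq, htq0, htq⟩ := exists_realising_qIdeles X hdiv
  have ht1 : ∀ (pp : Nat.Primes) (i : Fin X.lstar) (x : (thetaIndex X).Fibre (.inr pp)),
      haveI : Fact (pp : ℕ).Prime := ⟨pp.2⟩; placeOf X pp.1 x ∉ X.S → ‖t pp i x‖ = 1 :=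
    fun pp i x hx => norm_eq_one_of_realises X t ht0 ht pp i x hx
  have htq1 : ∀ (pp : Nat.Primes) (x : (thetaIndex X).Fibre (.inr pp)),
      haveI : Fact (pp : ℕ).Prime := ⟨pp.2⟩; placeOf X pp.1 x ∉ X.S → ‖tq pp x‖ = 1 :=
    fun pp x hx => qIdele_norm_eq_one_of_realises X tq htq0 htq pp x hx
  exact ⟨t, tq, ht0, ht, htq0, htq1, htq,
    thetaFinite_settingPrVolArchSharp X hlog hc M archPk archSub Ψ act Mmod region n lat sig split qData t tq ht0 ht1 htq0 htq1,
    bridgeHyps_settingPrVolArchSharp_of_ideles X hlog hc M archPk archSub Ψ act Mmod region n lat sig split qData t tq ht0 ht1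
      htq0 htq1,
    thetaRegionsAdm_settingPrVolArchSharp X hlog hc M archPk archSub Ψ act Mmod region n lat sig split qData t tq ht0 htq0 htq1,
    negLogQ_settingPrVolArchSharp X hlog hc M archPk archSub Ψ act Mmod region n lat sig split qData t tq htq0 htq1 htq,
    absLogQPos_settingPrVolArchSharp X hlog hc M archPk archSub Ψ act Mmod region n lat sig split qData t tq htq0 htq1 htq,
    statement_settingPrVolArchSharp_iff X hlog hc M archPk archSub Ψ act Mmod region n lat sig split qData t tq htq0 htq1 htq ht0 ht1,
    globalVolumeTransport_settingPrVolArchSharp_iff X hlog hc M archPk archSub Ψ act Mmod region n lat sig split qData t tq ht0 ht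
      htq0 htq1 htq⟩

end Real

end Thm311

end IUTFork

end Summit.ABC

end
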